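import Summits.HubbardSuperconductivity.HubbardLadder.R3R4SoundWindow
import HarnessLib

/-!
# Rung R3 — soundness of the ED-enclosure certificate, part 3/4: ground multiplets (§5)

HONEST FRAMING (page 1): ladder R1–R4 with certified numbers; no claim on H/H₀.
(The r3 seat's `R3R4Sound` split into four files for the 400-line limit, statements unchanged:
`R3R4SoundLinAlg` = §1, `R3R4SoundWindow` = §2–§4, `R3R4SoundMultiplet` = §5, `R3R4Sound` = §6 +
the overview docstring; import `R3R4Sound` to get everything. The `ℓ²` norm is the tree's
`Literature.MathematicalPhysics.QuantumLattice.eucNorm` (`ApproximateEigenvectorLemmas`) and the observable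
enclosure is a corollary of `GroundStateEnclosure.norm_expect_sub_expect_le`; the Davis–Kahan bound here,
`eucNorm_sub_proj_le_of_complement_gap`, is the variant of `GroundStateEnclosure.eucNorm_sub_proj_le_of_residual`
with the gap hypothesis on the TRIAL vector's complement inside a sector and the conclusion for every sector
ground state, which is the shape a certificate producer supplies.)

§5: the MULTIPLET format for a degenerate or nearly degenerate sector ground level: an orthonormal family
`φ₁ … φ_m`, `E_K ≤ ρ < β` with `β` bounding `H` below on `K ∩ {φ_i}^⊥`, gives `‖ψ - Σ ⟨φ_i, ψ⟩ φ_i‖ ≤ m ε / (β - ρ)`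
and a window from an enclosure of the correlator over the near-unit vectors of the span
(`ResidualComplementMultipletData.toWindow`). No certificate exists; these are soundness edges.
-/

namespace Summit.HubbardSuperconductivity.HubbardLadder

open Matrix Finset Filter Literature.Probability.LatticeModels
  Literature.MathematicalPhysics.QuantumLattice
open scoped ComplexOrder Topology InnerProductSpace

noncomputable section

/-! ## §5 Degenerate (or nearly degenerate) ground multiplets — the multiplet certificate

The one-vector format of §3 fails when the sector ground state is degenerate (`β ≤ ρ`). On the 4×4 torus
at `t' = 0` this is LIKELY: the nearest-neighbour 4×4 torus graph is `C₄ × C₄ ≅ Q₄` (the 4-cube), whose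
extra automorphisms produce multiplets beyond the lattice point group (elementary; `t' ≠ 0` breaks them).
Multiplet format: an orthonormal family `φ₁ … φ_m` in the sector with residuals `≤ ε`, the sector
ground energy `E_K ≤ ρ < β`, and `β` a lower bound on the Rayleigh quotient over the unit sector vectors
orthogonal to ALL `φ_i`. Then every unit sector ground state lies within `δ = m ε / (β - ρ)` of
`span{φ_i}` and its correlator is within `C_d² (2δ + δ²)` of that of its projection `u`
(`1 - δ² ≤ ‖u‖² ≤ 1`), which the certificate encloses over the span (an `m × m` compression). -/

section Multiplet

variable {n : Type*} [Fintype n] [DecidableEq n]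

omit [DecidableEq n] in
/-- The residual of the orthogonal projection onto an orthonormal family is orthogonal to the
family. [folklore] -/
theorem star_dotProduct_sub_sum_proj_eq_zero {m : ℕ} {φ : Fin m → (n → ℂ)}
    (horth : ∀ i j, star (φ i) ⬝ᵥ φ j = if i = j then 1 else 0) (ψ : n → ℂ) (i : Fin m) :
    star (φ i) ⬝ᵥ (ψ - ∑ j, (star (φ j) ⬝ᵥ ψ) • φ j) = 0 := by
  have hsum : star (φ i) ⬝ᵥ (∑ j, (star (φ j) ⬝ᵥ ψ) • φ j) = star (φ i) ⬝ᵥ ψ := by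
    rw [dotProduct_sum]
    simp_rw [dotProduct_smul, horth, smul_eq_mul, mul_ite, mul_one, mul_zero]
    rw [Finset.sum_ite_eq]
    simp
  rw [dotProduct_sub, hsum, sub_self]

omit [DecidableEq n] in
/-- The projection onto the family is `star`-orthogonal to the residual. [folklore] -/
theorem star_sum_proj_dotProduct_sub_eq_zero {m : ℕ} {φ : Fin m → (n → ℂ)}
    (horth : ∀ i j, star (φ i) ⬝ᵥ φ j = if i = j then 1 else 0) (ψ : n → ℂ) :
    star (∑ j, (star (φ j) ⬝ᵥ ψ) • φ j) ⬝ᵥ (ψ - ∑ j, (star (φ j) ⬝ᵥ ψ) • φ j) = 0 := by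
  rw [star_sum, sum_dotProduct]
  refine Finset.sum_eq_zero fun i _ => ?_
  rw [star_smul, smul_dotProduct, star_dotProduct_sub_sum_proj_eq_zero horth ψ i, smul_zero]

omit [DecidableEq n] in
/-- **Residual + complement gap ⇒ enclosure by a multiplet span (proved).** [folklore] -/
theorem eucNorm_sub_sum_proj_le_of_residuals {A : Matrix n n ℂ} (K : Submodule ℂ (n → ℂ)) {m : ℕ}
    {φ : Fin m → (n → ℂ)} {ψ : n → ℂ} {σ : Fin m → ℂ} {E ρ ε β : ℝ}
    (hφK : ∀ i, φ i ∈ K) (horth : ∀ i j, star (φ i) ⬝ᵥ φ j = if i = j then 1 else 0)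
    (hres : ∀ i, eucNorm (A *ᵥ φ i - σ i • φ i) ≤ ε) (hE : E ≤ ρ) (hβ : ρ < β)
    (hcomp : ∀ v ∈ K, (∀ i, star (φ i) ⬝ᵥ v = 0) → star v ⬝ᵥ v = 1 →
      β ≤ (star v ⬝ᵥ A *ᵥ v).re)
    (hψK : ψ ∈ K) (hψ : star ψ ⬝ᵥ ψ = 1) (heig : A *ᵥ ψ = (E : ℂ) • ψ) :
    eucNorm (ψ - ∑ i, (star (φ i) ⬝ᵥ ψ) • φ i) ≤ m * ε / (β - ρ) := by
  set α : Fin m → ℂ := fun i => star (φ i) ⬝ᵥ ψ with hα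
  have hφw : ∀ i, star (φ i) ⬝ᵥ (ψ - ∑ j, α j • φ j) = 0 :=
    star_dotProduct_sub_sum_proj_eq_zero horth ψ
  set w : n → ℂ := ψ - ∑ i, α i • φ i with hw
  have hβρ : 0 < β - ρ := sub_pos.2 hβ
  have hmε : 0 ≤ (m : ℝ) * ε := by
    cases m with
    | zero => simp
    | succ k => exact mul_nonneg (by positivity) ((eucNorm_nonneg _).trans (hres 0))
  have hφ1 : ∀ i, eucNorm (φ i) = 1 := fun i =>
    eucNorm_eq_one (by rw [horth i i, if_pos rfl])
  have hwφ : ∀ i, star w ⬝ᵥ φ i = 0 := fun i => by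
    rw [Matrix.star_dotProduct, hφw i, star_zero]
  have hwK : w ∈ K :=
    K.sub_mem hψK (Submodule.sum_mem _ fun i _ => K.smul_mem _ (hφK i))
  have hψ_dec : ψ = (∑ i, α i • φ i) + w := by rw [hw]; abel
  have hα1 : ∀ i, ‖α i‖ ≤ 1 := by
    intro i
    have h := norm_star_dotProduct_le (φ i) ψ
    rwa [hφ1 i, eucNorm_eq_one hψ, one_mul] at h
  have hwP : star w ⬝ᵥ (∑ i, α i • φ i) = 0 := by
    rw [dotProduct_sum]
    simp [dotProduct_smul, hwφ]
  have hwψ : star w ⬝ᵥ ψ = ((eucNorm w ^ 2 : ℝ) : ℂ) := by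
    have h : star w ⬝ᵥ ψ = star w ⬝ᵥ ((∑ i, α i • φ i) + w) := by rw [← hψ_dec]
    rw [h, dotProduct_add, hwP, zero_add, star_dotProduct_self_eq_eucNorm_sq]
  have hwAφ : ∀ i, star w ⬝ᵥ A *ᵥ φ i = star w ⬝ᵥ (A *ᵥ φ i - σ i • φ i) := by
    intro i
    have h : A *ᵥ φ i = (A *ᵥ φ i - σ i • φ i) + σ i • φ i := by abel
    conv_lhs => rw [h]
    rw [dotProduct_add, dotProduct_smul, hwφ i, smul_zero, add_zero]
  have hwAw : star w ⬝ᵥ A *ᵥ w =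
      (E : ℂ) * ((eucNorm w ^ 2 : ℝ) : ℂ) - ∑ i, α i * (star w ⬝ᵥ (A *ᵥ φ i - σ i • φ i)) := by
    have hAw : A *ᵥ w = (E : ℂ) • ψ - ∑ i, α i • (A *ᵥ φ i) := by
      rw [hw, mulVec_sub, heig, Matrix.mulVec_sum]
      simp_rw [mulVec_smul]
    rw [hAw, dotProduct_sub, dotProduct_smul, hwψ, smul_eq_mul, dotProduct_sum]
    congr 1
    refine Finset.sum_congr rfl fun i _ => ?_
    rw [dotProduct_smul, hwAφ i, smul_eq_mul]
  -- upper bound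
  have hup : (star w ⬝ᵥ A *ᵥ w).re ≤ ρ * eucNorm w ^ 2 + (m * ε) * eucNorm w := by
    rw [hwAw, Complex.sub_re, ← Complex.ofReal_mul, Complex.ofReal_re]
    have h2 : -(∑ i, α i * (star w ⬝ᵥ (A *ᵥ φ i - σ i • φ i))).re ≤ (m * ε) * eucNorm w := by
      calc -(∑ i, α i * (star w ⬝ᵥ (A *ᵥ φ i - σ i • φ i))).re
          ≤ ‖∑ i, α i * (star w ⬝ᵥ (A *ᵥ φ i - σ i • φ i))‖ := by
            rw [← Complex.neg_re]; exact (Complex.re_le_norm _).trans_eq (norm_neg _)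
        _ ≤ ∑ i, ‖α i * (star w ⬝ᵥ (A *ᵥ φ i - σ i • φ i))‖ := norm_sum_le _ _
        _ ≤ ∑ _i : Fin m, eucNorm w * ε := Finset.sum_le_sum fun i _ => by
            rw [norm_mul]
            calc ‖α i‖ * ‖star w ⬝ᵥ (A *ᵥ φ i - σ i • φ i)‖
                ≤ 1 * (eucNorm w * eucNorm (A *ᵥ φ i - σ i • φ i)) :=
                  mul_le_mul (hα1 i) (norm_star_dotProduct_le _ _) (norm_nonneg _) zero_le_one
              _ ≤ eucNorm w * ε := by
                  rw [one_mul]; exact mul_le_mul_of_nonneg_left (hres i) (eucNorm_nonneg w)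
        _ = (m * ε) * eucNorm w := by
            rw [Finset.sum_const, Finset.card_univ, Fintype.card_fin, nsmul_eq_mul]; ring
    have h3 : E * eucNorm w ^ 2 ≤ ρ * eucNorm w ^ 2 := mul_le_mul_of_nonneg_right hE (sq_nonneg _)
    linarith
  -- lower bound
  have hlow : β * eucNorm w ^ 2 ≤ (star w ⬝ᵥ A *ᵥ w).re :=
    mul_eucNorm_sq_le_of_unit_bound fun c _ hunit =>
      hcomp _ (K.smul_mem _ hwK) (fun i => by rw [dotProduct_smul, hφw i, smul_zero]) hunit
  have hkey : (β - ρ) * eucNorm w ^ 2 ≤ (m * ε) * eucNorm w := by nlinarith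
  rw [le_div_iff₀ hβρ]
  by_cases hw0 : eucNorm w = 0
  · rw [hw0, zero_mul]; exact hmε
  · have hpos : 0 < eucNorm w := lt_of_le_of_ne (eucNorm_nonneg w) (Ne.symm hw0)
    have h : (β - ρ) * eucNorm w ≤ m * ε := by
      rw [sq, ← mul_assoc] at hkey
      exact le_of_mul_le_mul_right hkey hpos
    linarith

omit [DecidableEq n] in
/-- **Observable enclosure for a `star`-orthogonal decomposition `ψ = u + w` of a unit vector
(proved):** `|⟨ψ, O ψ⟩ - ⟨u, O u⟩| ≤ M (2δ + δ²)` when `‖w‖ ≤ δ`; moreover `1 - δ² ≤ ‖u‖² ≤ 1`.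
[folklore] -/
theorem norm_expect_sub_expect_le_of_decomp {O : Matrix n n ℂ} {M δ : ℝ} {u w ψ : n → ℂ}
    (hO : ∀ a b : n → ℂ, ‖star a ⬝ᵥ O *ᵥ b‖ ≤ M * eucNorm a * eucNorm b)
    (hψ : ψ = u + w) (hψ1 : star ψ ⬝ᵥ ψ = 1) (huw : star u ⬝ᵥ w = 0) (hδ : eucNorm w ≤ δ) :
    ‖star ψ ⬝ᵥ O *ᵥ ψ - star u ⬝ᵥ O *ᵥ u‖ ≤ M * (2 * δ + δ ^ 2) ∧
      eucNorm u ≤ 1 ∧ 1 - δ ^ 2 ≤ eucNorm u ^ 2 := by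
  have hψn : eucNorm ψ = 1 := eucNorm_eq_one hψ1
  have h1 : eucNorm u ^ 2 + eucNorm w ^ 2 = 1 := by
    rw [← eucNorm_sq_add_of_orthogonal huw, ← hψ, hψn, one_pow]
  have hnu := eucNorm_nonneg u
  have hnw := eucNorm_nonneg w
  have hu : eucNorm u ≤ 1 := by nlinarith
  have hul : 1 - δ ^ 2 ≤ eucNorm u ^ 2 := by nlinarith [pow_le_pow_left₀ hnw hδ 2]
  have hM : 0 ≤ M := by
    have h := hO ψ ψ
    rw [hψn, mul_one, mul_one] at h
    exact (norm_nonneg _).trans h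
  refine ⟨?_, hu, hul⟩
  have hexp : star ψ ⬝ᵥ O *ᵥ ψ - star u ⬝ᵥ O *ᵥ u =
      star u ⬝ᵥ O *ᵥ w + star w ⬝ᵥ O *ᵥ u + star w ⬝ᵥ O *ᵥ w := by
    rw [hψ, star_add, mulVec_add, add_dotProduct, dotProduct_add, dotProduct_add]
    ring
  have b1 : eucNorm u * eucNorm w ≤ δ := by
    have := mul_le_mul hu hδ hnw zero_le_one
    rwa [one_mul] at this
  have b2 : eucNorm w * eucNorm w ≤ δ ^ 2 := by
    rw [sq]; exact mul_le_mul hδ hδ hnw (hnw.trans hδ)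
  calc ‖star ψ ⬝ᵥ O *ᵥ ψ - star u ⬝ᵥ O *ᵥ u‖
      = ‖star u ⬝ᵥ O *ᵥ w + star w ⬝ᵥ O *ᵥ u + star w ⬝ᵥ O *ᵥ w‖ := by rw [hexp]
    _ ≤ ‖star u ⬝ᵥ O *ᵥ w‖ + ‖star w ⬝ᵥ O *ᵥ u‖ + ‖star w ⬝ᵥ O *ᵥ w‖ :=
        (norm_add_le _ _).trans (add_le_add (norm_add_le _ _) le_rfl)
    _ ≤ M * eucNorm u * eucNorm w + M * eucNorm w * eucNorm u + M * eucNorm w * eucNorm w :=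
        add_le_add (add_le_add (hO u w) (hO w u)) (hO w w)
    _ = M * (eucNorm u * eucNorm w) + M * (eucNorm u * eucNorm w) + M * (eucNorm w * eucNorm w) := by
        ring
    _ ≤ M * δ + M * δ + M * δ ^ 2 :=
        add_le_add (add_le_add (mul_le_mul_of_nonneg_left b1 hM)
          (mul_le_mul_of_nonneg_left b1 hM)) (mul_le_mul_of_nonneg_left b2 hM)
    _ = M * (2 * δ + δ ^ 2) := by ring

end Multiplet

/-- **R3-0-ED multiplet certificate data** at `(H, N, L, r)`: an orthonormal family of `m` explicit
approximate ground vectors, residual / energy / complement-gap bounds, and an enclosure of the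
correlator over the near-unit vectors of their span (in practice from the `m × m` compressions of
`O_r` and of the Gram form). [folklore] -/
structure ResidualComplementMultipletData (H : TorusHamiltonianFamily) (N : ℕ → ℕ) (L : ℕ)
    (r : Site 2) where
  /-- size of the family -/
  m : ℕ
  /-- the certified approximate ground vectors -/
  φ : Fin m → Fock (Orb (FermionTorus 2 L))
  /-- residual shifts -/
  σ : Fin m → ℂ
  /-- certified upper bound on the sector ground energy -/
  ρ : ℝ
  /-- certified common residual bound -/
  ε : ℝ
  /-- certified complement Rayleigh lower bound -/
  β : ℝ
  /-- certified enclosure of `P̄_d(L, r; u)` over near-unit `u` in the span -/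
  glo : ℝ
  ghi : ℝ
  herm : (H L).IsHermitian
  mem : ∀ i, φ i ∈ szSector (Λ := FermionTorus 2 L) (N L) 0
  orth : ∀ i j, star (φ i) ⬝ᵥ φ j = if i = j then 1 else 0
  energy_le : (H L).minEnergyOn (szSector (Λ := FermionTorus 2 L) (N L) 0) ≤ ρ
  residual_le : ∀ i, eucNorm ((H L) *ᵥ φ i - σ i • φ i) ≤ ε
  gap : ρ < β
  complement : ∀ v ∈ szSector (Λ := FermionTorus 2 L) (N L) 0, (∀ i, star (φ i) ⬝ᵥ v = 0) →
    star v ⬝ᵥ v = 1 → β ≤ (star v ⬝ᵥ (H L) *ᵥ v).re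
  value_range : ∀ u ∈ Submodule.span ℂ (Set.range φ),
    1 - (m * ε / (β - ρ)) ^ 2 ≤ eucNorm u ^ 2 → eucNorm u ≤ 1 →
      glo ≤ avgPairCorr L r u ∧ avgPairCorr L r u ≤ ghi

namespace ResidualComplementMultipletData

variable {H : TorusHamiltonianFamily} {N : ℕ → ℕ} {L : ℕ} {r : Site 2}

/-- The span-enclosure radius `δ = m ε / (β - ρ)`. [folklore] -/
def δ (d : ResidualComplementMultipletData H N L r) : ℝ := d.m * d.ε / (d.β - d.ρ)

/-- The correlator slack `C_d² (2δ + δ²)`. [folklore] -/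
def slack (d : ResidualComplementMultipletData H N L r) : ℝ :=
  dWaveLocalPairNormConst ^ 2 * (2 * d.δ + d.δ ^ 2)

/-- The certified Rayleigh value of any member gives the `energy_le` field
(`minEnergyOn_le_rayleigh_of_mem`). [folklore] -/
theorem energy_le_of_rayleigh {L : ℕ} {K : Submodule ℂ (Fock (Orb (FermionTorus 2 L)))}
    {A : Matrix _ _ ℂ} (hA : A.IsHermitian) {φ₀ : Fock (Orb (FermionTorus 2 L))} {ρ : ℝ}
    (h₀ : φ₀ ∈ K) (h1 : star φ₀ ⬝ᵥ φ₀ = 1) (hρ : (star φ₀ ⬝ᵥ A *ᵥ φ₀).re ≤ ρ) :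
    A.minEnergyOn K ≤ ρ :=
  (minEnergyOn_le_rayleigh_of_mem hA K h₀ h1).trans hρ

/-- **Soundness of the multiplet certificate (proved).** Every normalised sector ground state `ψ`
has `glo - slack ≤ P̄_d(L, r; ψ) ≤ ghi + slack`. [folklore] -/
theorem window (d : ResidualComplementMultipletData H N L r)
    (ψ : Fock (Orb (FermionTorus 2 L))) (hψ : star ψ ⬝ᵥ ψ = 1)
    (hgs : IsGroundStateInSector (H L) (N L) 0 ψ) :
    d.glo - d.slack ≤ avgPairCorr L r ψ ∧ avgPairCorr L r ψ ≤ d.ghi + d.slack := by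
  set u : Fock (Orb (FermionTorus 2 L)) := ∑ i, (star (d.φ i) ⬝ᵥ ψ) • d.φ i with hu
  set w : Fock (Orb (FermionTorus 2 L)) := ψ - u with hw
  have hδ : eucNorm w ≤ d.δ :=
    eucNorm_sub_sum_proj_le_of_residuals (szSector (N L) 0) d.mem d.orth d.residual_le d.energy_le
      d.gap d.complement hgs.1 hψ hgs.2.2
  have hdec : ψ = u + w := by rw [hw]; abel
  have huw : star u ⬝ᵥ w = 0 := star_sum_proj_dotProduct_sub_eq_zero d.orth ψ
  have huspan : u ∈ Submodule.span ℂ (Set.range d.φ) :=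
    Submodule.sum_mem _ fun i _ => Submodule.smul_mem _ _ (Submodule.subset_span ⟨i, rfl⟩)
  have hC := dWaveLocalPairNormConst_nonneg
  have hδ0 : 0 ≤ d.δ := (eucNorm_nonneg _).trans hδ
  cases L with
  | zero =>
    -- every correlator is `0` on the empty torus
    have hO0 : ∀ a b : Fock (Orb (FermionTorus 2 0)), ‖star a ⬝ᵥ (0 : Matrix _ _ ℂ) *ᵥ b‖ ≤
        0 * eucNorm a * eucNorm b := fun a b => by simp
    obtain ⟨-, hu1, hul⟩ := norm_expect_sub_expect_le_of_decomp hO0 hdec hψ huw hδ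
    obtain ⟨hlo, hhi⟩ := d.value_range u huspan hul hu1
    simp only [avgPairCorr] at hlo hhi ⊢
    have hs : 0 ≤ d.slack := by unfold slack; positivity
    constructor <;> linarith
  | succ k =>
    obtain ⟨hobs, hu1, hul⟩ := norm_expect_sub_expect_le_of_decomp
      (norm_star_dotProduct_pairCorrOp_le (k + 1) r) hdec hψ huw hδ
    obtain ⟨hlo, hhi⟩ := d.value_range u huspan hul hu1
    have hre := (Complex.abs_re_le_norm _).trans hobs
    rw [Complex.sub_re] at hre
    rw [avgPairCorr_eq_re_expect_pairCorrOp] at hlo hhi ⊢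
    have hL : (0 : ℝ) < ((k + 1 : ℕ) : ℝ) ^ 2 := by positivity
    have hs : d.slack * ((k + 1 : ℕ) : ℝ) ^ 2 =
        ((k + 1 : ℕ) : ℝ) ^ 2 * dWaveLocalPairNormConst ^ 2 * (2 * d.δ + d.δ ^ 2) := by
      unfold slack; ring
    obtain ⟨h1, h2⟩ := abs_le.1 hre
    have hA := (le_div_iff₀ hL).1 hlo
    have hB := (div_le_iff₀ hL).1 hhi
    constructor
    · rw [le_div_iff₀ hL, sub_mul, hs]
      linarith
    · rw [div_le_iff₀ hL, add_mul, hs]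
      linarith

/-- **`PairCorrWindowCert` from the multiplet certificate.** [folklore] -/
def toWindow (d : ResidualComplementMultipletData H N L r) : PairCorrWindowCert H N L r where
  lo := d.glo - d.slack
  hi := d.ghi + d.slack
  sound ψ hψ hgs := d.window ψ hψ hgs

end ResidualComplementMultipletData

end

end Summit.HubbardSuperconductivity.HubbardLadder
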